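import Summits.Parity.GeneralizedHardyLittlewood.Theorems.TableChowla.Negative.HelsonStubsLoadBearing

/-!
# Line `helson-kronecker-inverse` (crux `TableChowla`, stmt-Parity-14270): the lever `InverseCM`
# calibrated at `c = 0`, and the lever minus complete multiplicativity PROVED (delocalisation)

Companion of `HelsonStubsLoadBearing.lean` (drefute seat; stub statements restated textually inside the
theorems — no new definition — entry `lam (Int.toNat (a*b+c))`).

* `inverseCM_shift_zero` — CALIBRATION: `stub_inverse`'s statement `InverseCM` with `c = 0`
  substituted (the rank-one instance excluded by the crux's `c ≠ 0`) HOLDS, with `C' = 1`, by the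
  completely multiplicative witness `g = λ` itself: `∑_a ‖∑_{b ≤ x/A} λ(b)λ(ab)‖² = rows·⌊x/A⌋² ≥ x(x/A)/8`;
  and `inverseCM_shift_zero_fires` — NOT vacuously: the unit pair `u = λ/√rows`, `v = λ/√B` has
  `uᵀ M₀ v = √(rows·B) ≥ √x/2 ≥ √x/(log x)^C` eventually. So `c ≠ 0` is not load-bearing for the lever,
  and at the rank-one instance the near-extremal direction IS completely multiplicative, as the line
  predicts (informative, not a refutation).
* `delocalise`, `inverseCM_without_CM` — `InverseCM` with the clause `∀ m n, g (m*n) = g m * g n`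
  DELETED from its conclusion is a THEOREM (`C' = 4C + 1`): truncate the near-extremal column vector at
  height `τ = 2(log x)^C √rows/√x` and rescale by `1/τ` (`|v_b| > τ ⇒ |v_b| ≤ v_b²/τ` bounds the
  discarded part by `√rows/τ`; Cauchy–Schwarz in the rows does the rest). Hence the ENTIRE content of
  `stub_inverse` is the upgrade "1-bounded delocalised near-extremiser ⇒ completely multiplicative
  near-extremiser".
[folklore]
-/

namespace Summit.Parity.GeneralizedHardyLittlewood.Theorems.TableChowla.Negative

open Finset Real ArithmeticFunction
open Summit.Parity.GeneralizedHardyLittlewood.Theses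

noncomputable section

/-! ## Calibration: the lever `InverseCM` at `c = 0` holds, and not vacuously -/

/-- CALIBRATION. The lever `InverseCM` of line `helson-kronecker-inverse` with `c = 0` substituted
(the rank-one instance, excluded by the crux's `c ≠ 0`) HOLDS, with `C' = 1`: whatever the
near-extremal pair `(u, v)`, the completely multiplicative 1-bounded witness is `g = λ` on the full
column range `y = x/A`, where `∑_a ‖∑_{b ≤ ⌊x/A⌋} λ(b)λ(ab)‖² = rows·⌊x/A⌋² ≥ x(x/A)/8 ≥ x(x/A)/log x`. -/
theorem inverseCM_shift_zero :
    ∀ δ : ℝ, 0 < δ → δ ≤ 1 / 12 → ∀ C : ℝ, 0 < C → ∃ C' : ℝ, 0 < C' ∧ ∃ x₀ : ℝ,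
    ∀ x : ℝ, x₀ ≤ x → ∀ A : ℝ, x ^ δ ≤ A → A ≤ x ^ (1 / 3 + δ) →
    ∀ u v : ℕ → ℝ, (∑ a ∈ Ioc ⌊A⌋₊ ⌊2 * A⌋₊, u a ^ 2 ≤ 1) →
      (∑ b ∈ Icc 1 ⌊x / A⌋₊, v b ^ 2 ≤ 1) →
      x ^ (1 / 2 : ℝ) / Real.log x ^ C ≤
        |∑ a ∈ Ioc ⌊A⌋₊ ⌊2 * A⌋₊, ∑ b ∈ Icc 1 ⌊x / A⌋₊,
          u a * v b * lam (Int.toNat ((a : ℤ) * b + 0))| →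
      ∃ g : ℕ → ℂ, (∀ m n : ℕ, g (m * n) = g m * g n) ∧ (∀ n : ℕ, ‖g n‖ ≤ 1) ∧
        ∃ y : ℝ, y ≤ x / A ∧
          x * (x / A) / Real.log x ^ C' ≤
            ∑ a ∈ Ioc ⌊A⌋₊ ⌊2 * A⌋₊,
              ‖∑ b ∈ Icc 1 ⌊y⌋₊, g b * (lam (Int.toNat ((a : ℤ) * b + 0)) : ℂ)‖ ^ 2 := by
  intro δ hδ hδ' C _
  refine ⟨1, one_pos, max (Real.exp 8) ((2 : ℝ) ^ (1 / δ)), ?_⟩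
  intro x hx A hA hA' u v _ _ _
  refine ⟨fun n : ℕ => ((lam n : ℝ) : ℂ), fun m n => lamC_mul m n, norm_lamC_le_one, x / A, le_rfl, ?_⟩
  obtain ⟨hA2, hxA, hlog⟩ := window_lower hδ hδ' hx hA hA'
  have hApos : 0 < A := by linarith
  have hxApos : 0 < x / A := by linarith
  have hxpos : 0 < x := by
    have := mul_pos hApos hxApos
    rwa [mul_div_cancel₀ _ hApos.ne'] at this
  have hR : A / 2 ≤ ((Ioc ⌊A⌋₊ ⌊2 * A⌋₊).card : ℝ) := by
    have := sub_one_le_card_rows hApos.le; linarith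
  have hB : x / A / 2 ≤ (⌊x / A⌋₊ : ℝ) := by
    have := Nat.lt_floor_add_one (x / A); linarith
  rw [meanSquare_lamC_shift_zero, Real.rpow_one]
  calc x * (x / A) / Real.log x ≤ x * (x / A) / 8 :=
        div_le_div_of_nonneg_left (by positivity) (by norm_num) hlog
    _ = (A / 2) * (x / A / 2) ^ 2 := by field_simp; ring
    _ ≤ ((Ioc ⌊A⌋₊ ⌊2 * A⌋₊).card : ℝ) * (⌊x / A⌋₊ : ℝ) ^ 2 :=
        mul_le_mul hR (pow_le_pow_left₀ (by positivity) hB 2) (by positivity) (by positivity)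

/-- … and NOT vacuously: at `c = 0` the hypothesis of the lever FIRES for every `C > 0` beyond a
threshold — the unit pair `u = λ/√rows`, `v = λ/√B` has `uᵀ M₀ v = √(rows · B) ≥ √(x/4) = √x/2 ≥ √x/(log x)^C`
once `(log x)^C ≥ 2`. -/
theorem inverseCM_shift_zero_fires :
    ∀ δ : ℝ, 0 < δ → δ ≤ 1 / 12 → ∀ C : ℝ, 0 < C → ∃ x₀ : ℝ,
    ∀ x : ℝ, x₀ ≤ x → ∀ A : ℝ, x ^ δ ≤ A → A ≤ x ^ (1 / 3 + δ) →
    ∃ u v : ℕ → ℝ, (∑ a ∈ Ioc ⌊A⌋₊ ⌊2 * A⌋₊, u a ^ 2 ≤ 1) ∧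
      (∑ b ∈ Icc 1 ⌊x / A⌋₊, v b ^ 2 ≤ 1) ∧
      x ^ (1 / 2 : ℝ) / Real.log x ^ C ≤
        |∑ a ∈ Ioc ⌊A⌋₊ ⌊2 * A⌋₊, ∑ b ∈ Icc 1 ⌊x / A⌋₊,
          u a * v b * lam (Int.toNat ((a : ℤ) * b + 0))| := by
  intro δ hδ hδ' C hC
  obtain ⟨X, hX⟩ := eventually_rpow_log_ge hC 2
  refine ⟨max (max (Real.exp 8) ((2 : ℝ) ^ (1 / δ))) X, ?_⟩
  intro x hx A hA hA'
  have hx1 : max (Real.exp 8) ((2 : ℝ) ^ (1 / δ)) ≤ x := le_trans (le_max_left _ _) hx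
  have hxX : X ≤ x := le_trans (le_max_right _ _) hx
  obtain ⟨hA2, hxA, hlog⟩ := window_lower hδ hδ' hx1 hA hA'
  have hLC : 2 ≤ Real.log x ^ C := (hX x hxX).1
  have hApos : 0 < A := by linarith
  have hxApos : 0 < x / A := by linarith
  have hxpos : 0 < x := by
    have := mul_pos hApos hxApos
    rwa [mul_div_cancel₀ _ hApos.ne'] at this
  -- sizes of the row and column index sets
  set R : ℝ := ((Ioc ⌊A⌋₊ ⌊2 * A⌋₊).card : ℝ) with hRdef
  set B : ℝ := (⌊x / A⌋₊ : ℝ) with hBdef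
  have hR : A / 2 ≤ R := by have := sub_one_le_card_rows hApos.le; rw [hRdef]; linarith
  have hB : x / A / 2 ≤ B := by have := Nat.lt_floor_add_one (x / A); rw [hBdef]; linarith
  have hRpos : 0 < R := by linarith
  have hBpos : 0 < B := by linarith
  -- the test vectors
  refine ⟨fun a => lam a / Real.sqrt R, fun b => lam b / Real.sqrt B, ?_, ?_, ?_⟩
  · -- `∑ u² = rows / R = 1`
    have h : ∀ a ∈ Ioc ⌊A⌋₊ ⌊2 * A⌋₊, (lam a / Real.sqrt R) ^ 2 = 1 / R := by
      intro a ha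
      have ha0 : a ≠ 0 := by
        simp only [mem_Ioc] at ha
        have : 1 ≤ ⌊A⌋₊ := Nat.le_floor (by exact_mod_cast (show (1:ℝ) ≤ A by linarith))
        omega
      rw [div_pow, lam_sq ha0, Real.sq_sqrt hRpos.le]
    rw [sum_congr rfl h, sum_const, nsmul_eq_mul, ← hRdef, mul_one_div, div_self hRpos.ne']
  · have h : ∀ b ∈ Icc 1 ⌊x / A⌋₊, (lam b / Real.sqrt B) ^ 2 = 1 / B := by
      intro b hb
      have hb0 : b ≠ 0 := by simp only [mem_Icc] at hb; omega
      rw [div_pow, lam_sq hb0, Real.sq_sqrt hBpos.le]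
    rw [sum_congr rfl h, sum_const, nsmul_eq_mul, Nat.card_Icc, Nat.add_sub_cancel, ← hBdef,
      mul_one_div, div_self hBpos.ne']
  · -- the form equals `R·B/(√R √B) = √(R B) ≥ √x / 2`
    have hterm : ∀ a ∈ Ioc ⌊A⌋₊ ⌊2 * A⌋₊, ∀ b ∈ Icc 1 ⌊x / A⌋₊,
        lam a / Real.sqrt R * (lam b / Real.sqrt B) * lam (Int.toNat ((a : ℤ) * b + 0)) =
          1 / (Real.sqrt R * Real.sqrt B) := by
      intro a ha b hb
      have ha0 : a ≠ 0 := by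
        simp only [mem_Ioc] at ha
        have : 1 ≤ ⌊A⌋₊ := Nat.le_floor (by exact_mod_cast (show (1:ℝ) ≤ A by linarith))
        omega
      have hb0 : b ≠ 0 := by simp only [mem_Icc] at hb; omega
      have hsa : lam a * lam a = 1 := by rw [← sq]; exact lam_sq ha0
      have hsb : lam b * lam b = 1 := by rw [← sq]; exact lam_sq hb0
      rw [entry_shift_zero, lam_mul]
      have hsR : Real.sqrt R ≠ 0 := (Real.sqrt_pos.mpr hRpos).ne'
      have hsB : Real.sqrt B ≠ 0 := (Real.sqrt_pos.mpr hBpos).ne'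
      field_simp
      linear_combination hsa * (lam b * lam b) + hsb
    have hform : ∑ a ∈ Ioc ⌊A⌋₊ ⌊2 * A⌋₊, ∑ b ∈ Icc 1 ⌊x / A⌋₊,
        lam a / Real.sqrt R * (lam b / Real.sqrt B) * lam (Int.toNat ((a : ℤ) * b + 0)) =
          R * B / (Real.sqrt R * Real.sqrt B) := by
      rw [sum_congr rfl fun a ha => sum_congr rfl fun b hb => hterm a ha b hb]
      simp only [sum_const, nsmul_eq_mul, Nat.card_Icc, Nat.add_sub_cancel]
      rw [← hRdef, ← hBdef]; ring
    have hsqrt : R * B / (Real.sqrt R * Real.sqrt B) = Real.sqrt (R * B) := by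
      rw [← Real.sqrt_mul hRpos.le, eq_comm, Real.sqrt_eq_iff_mul_self_eq_of_pos (by positivity)]
      have hRB : 0 < Real.sqrt (R * B) := Real.sqrt_pos.mpr (by positivity)
      field_simp
      rw [Real.sq_sqrt (by positivity)]
    rw [hform, hsqrt, abs_of_nonneg (Real.sqrt_nonneg _)]
    -- `√x/(log x)^C ≤ √x/2 = √(x/4) ≤ √(R B)`
    have hRB : x / 4 ≤ R * B := by
      calc x / 4 = (A / 2) * (x / A / 2) := by field_simp; ring
        _ ≤ R * B := mul_le_mul hR hB (by positivity) hRpos.le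
    calc x ^ (1 / 2 : ℝ) / Real.log x ^ C ≤ x ^ (1 / 2 : ℝ) / 2 :=
          div_le_div_of_nonneg_left (by positivity) (by norm_num) hLC
      _ = Real.sqrt (x / 4) := by
          rw [Real.sqrt_div' x (by norm_num : (0:ℝ) ≤ 4), Real.sqrt_eq_rpow,
            show (4 : ℝ) = 2 ^ 2 by norm_num, Real.sqrt_sq (by norm_num : (0:ℝ) ≤ 2)]
      _ ≤ Real.sqrt (R * B) := Real.sqrt_le_sqrt hRB

/-! ## The lever minus complete multiplicativity is elementary (delocalisation) -/

/-- The truncated, rescaled weight `v_b 𝟙[|v_b| ≤ τ] / τ` is 1-bounded. -/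
theorem abs_trunc_le_one (v : ℕ → ℝ) {τ : ℝ} (hτ : 0 < τ) (b : ℕ) :
    |(if |v b| ≤ τ then v b / τ else 0)| ≤ 1 := by
  split_ifs with h
  · rw [abs_div, abs_of_pos hτ, div_le_one hτ]; exact h
  · simp

/-- Cauchy–Schwarz against a 1-bounded kernel: `|∑_{a∈R} u_a e(a)| ≤ √#R` when `∑ u² ≤ 1`. -/
theorem abs_sum_mul_le_sqrt_card (e : ℕ → ℝ) (he : ∀ a, |e a| ≤ 1) (R : Finset ℕ) (u : ℕ → ℝ)
    (hu : ∑ a ∈ R, u a ^ 2 ≤ 1) : |∑ a ∈ R, u a * e a| ≤ Real.sqrt R.card := by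
  have he2 : ∑ a ∈ R, e a ^ 2 ≤ R.card := by
    calc ∑ a ∈ R, e a ^ 2 ≤ ∑ _a ∈ R, (1 : ℝ) := sum_le_sum fun a _ => by
            have h1 := he a
            have h0 := abs_nonneg (e a)
            rw [← sq_abs]
            nlinarith
      _ = R.card := by simp
  refine Real.abs_le_sqrt ?_
  calc (∑ a ∈ R, u a * e a) ^ 2 ≤ (∑ a ∈ R, u a ^ 2) * ∑ a ∈ R, e a ^ 2 :=
        sum_mul_sq_le_sq_mul_sq _ _ _
    _ ≤ 1 * (R.card : ℝ) := mul_le_mul hu he2 (sum_nonneg fun _ _ => sq_nonneg _) zero_le_one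
    _ = R.card := one_mul _

/-- DELOCALISATION. For `ℓ²`-unit `u, v`, a 1-bounded kernel `e` and a truncation height `τ > 0`
with `√#R/τ ≤ |uᵀ e v|`, the 1-bounded weight `t_b := v_b 𝟙[|v_b| ≤ τ]/τ` satisfies
`∑_{a∈R} (∑_{b∈S} t_b · e(a,b))² ≥ (|uᵀ e v| − √#R/τ)² / τ²`.  Proof: split `v = w + z` at height
`τ`; `|z_b| ≤ v_b²/τ` gives `|uᵀ e z| ≤ ∑_b |z_b|·|∑_a u_a e(a,b)| ≤ √#R/τ`, and
`|uᵀ e w|² ≤ ∑_a (∑_b w_b e(a,b))²` by Cauchy–Schwarz in `a`. -/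
theorem delocalise (e : ℕ → ℕ → ℝ) (he : ∀ a b, |e a b| ≤ 1) (R S : Finset ℕ) (u v : ℕ → ℝ)
    (hu : ∑ a ∈ R, u a ^ 2 ≤ 1) (hv : ∑ b ∈ S, v b ^ 2 ≤ 1) {τ : ℝ} (hτ : 0 < τ)
    (hT : Real.sqrt R.card / τ ≤ |∑ a ∈ R, ∑ b ∈ S, u a * v b * e a b|) :
    (|∑ a ∈ R, ∑ b ∈ S, u a * v b * e a b| - Real.sqrt R.card / τ) ^ 2 / τ ^ 2 ≤
      ∑ a ∈ R, (∑ b ∈ S, (if |v b| ≤ τ then v b / τ else 0) * e a b) ^ 2 := by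
  set Fv : ℝ := ∑ a ∈ R, ∑ b ∈ S, u a * v b * e a b with hFv
  -- small part `w` and big part `z` of `v`; `W = e w` row by row
  set w : ℕ → ℝ := fun b => if |v b| ≤ τ then v b else 0 with hw
  set z : ℕ → ℝ := fun b => v b - w b with hz
  set W : ℕ → ℝ := fun a => ∑ b ∈ S, w b * e a b with hW
  have hzb : ∀ b, |z b| ≤ v b ^ 2 / τ := by
    intro b
    simp only [hz, hw]
    split_ifs with h
    · rw [sub_self, abs_zero]; positivity
    · push Not at h
      rw [sub_zero, le_div_iff₀ hτ]
      calc |v b| * τ ≤ |v b| * |v b| := mul_le_mul_of_nonneg_left h.le (abs_nonneg _)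
        _ = v b ^ 2 := by rw [← sq, sq_abs]
  have hP : ∑ a ∈ R, ∑ b ∈ S, u a * w b * e a b = ∑ a ∈ R, u a * W a := by
    refine sum_congr rfl fun a _ => ?_
    rw [hW]; dsimp only; rw [mul_sum]
    exact sum_congr rfl fun b _ => by ring
  have hQ : ∑ a ∈ R, ∑ b ∈ S, u a * z b * e a b = ∑ b ∈ S, z b * ∑ a ∈ R, u a * e a b := by
    rw [sum_comm]
    refine sum_congr rfl fun b _ => ?_
    rw [mul_sum]
    exact sum_congr rfl fun a _ => by ring
  have hsplit : Fv = ∑ a ∈ R, u a * W a + ∑ b ∈ S, z b * ∑ a ∈ R, u a * e a b := by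
    rw [← hP, ← hQ, ← sum_add_distrib, hFv]
    refine sum_congr rfl fun a _ => ?_
    rw [← sum_add_distrib]
    refine sum_congr rfl fun b _ => ?_
    simp only [hz]; ring
  have hQabs : |∑ b ∈ S, z b * ∑ a ∈ R, u a * e a b| ≤ Real.sqrt R.card / τ := by
    calc |∑ b ∈ S, z b * ∑ a ∈ R, u a * e a b|
        ≤ ∑ b ∈ S, |z b * ∑ a ∈ R, u a * e a b| := abs_sum_le_sum_abs _ _
      _ ≤ ∑ b ∈ S, v b ^ 2 / τ * Real.sqrt R.card := by
          refine sum_le_sum fun b _ => ?_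
          rw [abs_mul]
          exact mul_le_mul (hzb b)
            (abs_sum_mul_le_sqrt_card (fun a => e a b) (fun a => he a b) R u hu)
            (abs_nonneg _) (by positivity)
      _ = (∑ b ∈ S, v b ^ 2) * (Real.sqrt R.card / τ) := by
          rw [sum_mul]; exact sum_congr rfl fun b _ => by ring
      _ ≤ 1 * (Real.sqrt R.card / τ) := mul_le_mul_of_nonneg_right hv (by positivity)
      _ = Real.sqrt R.card / τ := one_mul _
  have hPabs : |Fv| - Real.sqrt R.card / τ ≤ |∑ a ∈ R, u a * W a| := by
    have h := abs_add_le (∑ a ∈ R, u a * W a) (∑ b ∈ S, z b * ∑ a ∈ R, u a * e a b)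
    rw [← hsplit] at h
    linarith
  have hP0 : 0 ≤ |Fv| - Real.sqrt R.card / τ := by linarith
  have hP2 : (∑ a ∈ R, u a * W a) ^ 2 ≤ ∑ a ∈ R, W a ^ 2 :=
    calc (∑ a ∈ R, u a * W a) ^ 2 ≤ (∑ a ∈ R, u a ^ 2) * ∑ a ∈ R, W a ^ 2 :=
          sum_mul_sq_le_sq_mul_sq _ _ _
      _ ≤ 1 * ∑ a ∈ R, W a ^ 2 :=
          mul_le_mul_of_nonneg_right hu (sum_nonneg fun _ _ => sq_nonneg _)
      _ = ∑ a ∈ R, W a ^ 2 := one_mul _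
  -- the rescaled weight is `w/τ`
  have hg : ∀ a, ∑ b ∈ S, (if |v b| ≤ τ then v b / τ else 0) * e a b = W a / τ := by
    intro a
    rw [hW]; dsimp only; rw [sum_div]
    refine sum_congr rfl fun b _ => ?_
    simp only [hw]; split_ifs <;> ring
  simp_rw [hg, div_pow, ← sum_div]
  rw [div_le_div_iff_of_pos_right (by positivity : (0 : ℝ) < τ ^ 2)]
  calc (|Fv| - Real.sqrt R.card / τ) ^ 2 ≤ |∑ a ∈ R, u a * W a| ^ 2 := pow_le_pow_left₀ hP0 hPabs 2
    _ = (∑ a ∈ R, u a * W a) ^ 2 := sq_abs _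
    _ ≤ ∑ a ∈ R, W a ^ 2 := hP2

/-- THE LEVER WITHOUT "COMPLETELY MULTIPLICATIVE" IS A THEOREM. `stub_inverse`'s statement (`InverseCM`
of line `helson-kronecker-inverse`, entry via `lam`) with the clause `∀ m n, g (m * n) = g m * g n`
DELETED from its conclusion holds, with `C' = 4C + 1` and the full column range `y = x/A`: apply
`delocalise` at `τ = 2(log x)^C √rows / √x` (so `√rows/τ` is half the hypothesis' threshold) and use
`rows ≤ 2A`, `log x ≥ 32`. Consequently every difficulty of the lever is the COMPLETE MULTIPLICATIVITY
of the witness. -/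
theorem inverseCM_without_CM :
    ∀ c : ℤ, c ≠ 0 → ∀ δ : ℝ, 0 < δ → δ ≤ 1 / 12 → ∀ C : ℝ, 0 < C → ∃ C' : ℝ, 0 < C' ∧ ∃ x₀ : ℝ,
    ∀ x : ℝ, x₀ ≤ x → ∀ A : ℝ, x ^ δ ≤ A → A ≤ x ^ (1 / 3 + δ) →
    ∀ u v : ℕ → ℝ, (∑ a ∈ Ioc ⌊A⌋₊ ⌊2 * A⌋₊, u a ^ 2 ≤ 1) →
      (∑ b ∈ Icc 1 ⌊x / A⌋₊, v b ^ 2 ≤ 1) →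
      x ^ (1 / 2 : ℝ) / Real.log x ^ C ≤
        |∑ a ∈ Ioc ⌊A⌋₊ ⌊2 * A⌋₊, ∑ b ∈ Icc 1 ⌊x / A⌋₊,
          u a * v b * lam (Int.toNat ((a : ℤ) * b + c))| →
      ∃ g : ℕ → ℂ, (∀ n : ℕ, ‖g n‖ ≤ 1) ∧
        ∃ y : ℝ, y ≤ x / A ∧
          x * (x / A) / Real.log x ^ C' ≤
            ∑ a ∈ Ioc ⌊A⌋₊ ⌊2 * A⌋₊,
              ‖∑ b ∈ Icc 1 ⌊y⌋₊, g b * (lam (Int.toNat ((a : ℤ) * b + c)) : ℂ)‖ ^ 2 := by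
  intro c _ δ hδ hδ' C hC
  refine ⟨4 * C + 1, by linarith, max (max (Real.exp 8) ((2 : ℝ) ^ (1 / δ))) (Real.exp 32), ?_⟩
  intro x hx A hA hA' u v hu hv hbig
  have hx1 : max (Real.exp 8) ((2 : ℝ) ^ (1 / δ)) ≤ x := le_trans (le_max_left _ _) hx
  have hx32 : Real.exp 32 ≤ x := le_trans (le_max_right _ _) hx
  obtain ⟨hA2, hxA, -⟩ := window_lower hδ hδ' hx1 hA hA'
  have hApos : 0 < A := by linarith
  have hxApos : 0 < x / A := by linarith
  have hxpos : 0 < x := by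
    have := mul_pos hApos hxApos
    rwa [mul_div_cancel₀ _ hApos.ne'] at this
  have hlog : 32 ≤ Real.log x := (Real.le_log_iff_exp_le hxpos).mpr hx32
  set L : ℝ := Real.log x with hL
  have hLpos : 0 < L := by linarith
  set K : ℝ := L ^ C with hK
  have hKpos : 0 < K := Real.rpow_pos_of_pos hLpos C
  set Rs : Finset ℕ := Ioc ⌊A⌋₊ ⌊2 * A⌋₊ with hRs
  set R : ℝ := (Rs.card : ℝ) with hRdef
  have hRle : R ≤ 2 * A := by
    rw [hRdef, hRs, Nat.card_Ioc, Nat.cast_sub (Nat.floor_le_floor (by linarith : A ≤ 2 * A))]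
    have h1 : (⌊2 * A⌋₊ : ℝ) ≤ 2 * A := Nat.floor_le (by linarith)
    have h2 : A - 1 < (⌊A⌋₊ : ℝ) := by have := Nat.lt_floor_add_one A; linarith
    linarith
  have hRge : A / 2 ≤ R := by have := sub_one_le_card_rows hApos.le; rw [hRdef, hRs]; linarith
  have hRpos : 0 < R := by linarith
  have hhalf2 : (x ^ (1 / 2 : ℝ)) ^ 2 = x := by
    rw [← Real.rpow_natCast, ← Real.rpow_mul hxpos.le]; norm_num
  have hhalfpos : 0 < x ^ (1 / 2 : ℝ) := Real.rpow_pos_of_pos hxpos _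
  -- truncation height
  set τ : ℝ := 2 * K * Real.sqrt R / x ^ (1 / 2 : ℝ) with hτdef
  have hsR : 0 < Real.sqrt R := Real.sqrt_pos.mpr hRpos
  have hτpos : 0 < τ := by positivity
  have hRt : Real.sqrt R / τ = x ^ (1 / 2 : ℝ) / (2 * K) := by
    rw [hτdef]; field_simp
  have hτ2 : τ ^ 2 = 4 * K ^ 2 * R / x := by
    rw [hτdef, div_pow, hhalf2, mul_pow, mul_pow, Real.sq_sqrt hRpos.le]; ring
  -- the form
  set Fv : ℝ := ∑ a ∈ Rs, ∑ b ∈ Icc 1 ⌊x / A⌋₊, u a * v b * lam (Int.toNat ((a : ℤ) * b + c))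
    with hFv
  have hT : Real.sqrt R / τ ≤ |Fv| := by
    rw [hRt]
    have : x ^ (1 / 2 : ℝ) / (2 * K) ≤ x ^ (1 / 2 : ℝ) / K :=
      div_le_div_of_nonneg_left hhalfpos.le hKpos (by linarith)
    exact this.trans hbig
  have hdeloc := delocalise (fun a b => lam (Int.toNat ((a : ℤ) * b + c))) (fun a b => abs_lam_le_one _)
    Rs (Icc 1 ⌊x / A⌋₊) u v hu hv hτpos hT
  -- the witness: the truncated rescaled `v`, read as a complex weight, on the full column range
  set t : ℕ → ℝ := fun b => if |v b| ≤ τ then v b / τ else 0 with ht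
  have hdeloc' : (|Fv| - Real.sqrt R / τ) ^ 2 / τ ^ 2 ≤
      ∑ a ∈ Rs, (∑ b ∈ Icc 1 ⌊x / A⌋₊, t b * lam (Int.toNat ((a : ℤ) * b + c))) ^ 2 := hdeloc
  refine ⟨fun b => (t b : ℂ), fun n => ?_, x / A, le_rfl, ?_⟩
  · rw [Complex.norm_real, Real.norm_eq_abs]; exact abs_trunc_le_one v hτpos n
  have hreal : ∀ a : ℕ, ‖∑ b ∈ Icc 1 ⌊x / A⌋₊, (t b : ℂ) *
      (lam (Int.toNat ((a : ℤ) * b + c)) : ℂ)‖ ^ 2 =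
        (∑ b ∈ Icc 1 ⌊x / A⌋₊, t b * lam (Int.toNat ((a : ℤ) * b + c))) ^ 2 := by
    intro a
    have hc : ∑ b ∈ Icc 1 ⌊x / A⌋₊, (t b : ℂ) * (lam (Int.toNat ((a : ℤ) * b + c)) : ℂ) =
        ((∑ b ∈ Icc 1 ⌊x / A⌋₊, t b * lam (Int.toNat ((a : ℤ) * b + c)) : ℝ) : ℂ) := by
      push_cast; rfl
    rw [hc, Complex.norm_real, Real.norm_eq_abs, sq_abs]
  simp_rw [hreal]
  -- sizes: `x(x/A)/L^{4C+1} ≤ x²/(16 K⁴ R) = (√x/(2K))²/τ² ≤ (|Fv| − √R/τ)²/τ² ≤ mean square`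
  have hpow : L ^ (4 * C + 1) = K ^ 4 * L := by
    rw [Real.rpow_add hLpos, Real.rpow_one, mul_comm (4 : ℝ) C, Real.rpow_mul hLpos.le]
    congr 1
    rw [show (4 : ℝ) = ((4 : ℕ) : ℝ) by norm_num, Real.rpow_natCast]
  have hstep3 : x * (x / A) / L ^ (4 * C + 1) ≤ x ^ 2 / (16 * K ^ 4 * R) := by
    rw [hpow, div_le_div_iff₀ (by positivity) (by positivity)]
    have h16 : 16 * R ≤ L * A := by nlinarith
    have hrew : x * (x / A) * (16 * K ^ 4 * R) = x ^ 2 * K ^ 4 * (16 * R) / A := by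
      field_simp
    rw [hrew, div_le_iff₀ hApos]
    calc x ^ 2 * K ^ 4 * (16 * R) ≤ x ^ 2 * K ^ 4 * (L * A) :=
          mul_le_mul_of_nonneg_left h16 (by positivity)
      _ = x ^ 2 * (K ^ 4 * L) * A := by ring
  have hstep2 : (x ^ (1 / 2 : ℝ) / (2 * K)) ^ 2 / τ ^ 2 = x ^ 2 / (16 * K ^ 4 * R) := by
    rw [hτ2, div_pow, hhalf2]
    field_simp
    ring
  have hstep1 : (x ^ (1 / 2 : ℝ) / (2 * K)) ^ 2 / τ ^ 2 ≤ (|Fv| - Real.sqrt R / τ) ^ 2 / τ ^ 2 := by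
    apply div_le_div_of_nonneg_right _ (by positivity)
    apply pow_le_pow_left₀ (by positivity)
    rw [hRt]
    have hsplit : x ^ (1 / 2 : ℝ) / K = x ^ (1 / 2 : ℝ) / (2 * K) + x ^ (1 / 2 : ℝ) / (2 * K) := by
      field_simp; ring
    linarith [hbig]
  calc x * (x / A) / L ^ (4 * C + 1) ≤ x ^ 2 / (16 * K ^ 4 * R) := hstep3
    _ = (x ^ (1 / 2 : ℝ) / (2 * K)) ^ 2 / τ ^ 2 := hstep2.symm
    _ ≤ (|Fv| - Real.sqrt R / τ) ^ 2 / τ ^ 2 := hstep1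
    _ ≤ _ := hdeloc'

end

end Summit.Parity.GeneralizedHardyLittlewood.Theorems.TableChowla.Negative
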